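import Mathlib

/-!
# The unfolding of a convolution operator to its Poincaré-series kernel (support, seat p1)

The «unfolding» step of the geometric side of a two-period identity (memo §2e (a), STATUS l. 14985 (2)(a)): for a
countable subgroup `Γ` of a group `G` with a left-invariant measure `μ` and a fundamental domain `s` for the
left action of `Γ`, and for a left-`Γ`-invariant `ψ`,

  `R(f)ψ(x) := ∫_G f(g) ψ(x g) dμ(g) = ∫_G f(x⁻¹ g) ψ(g) dμ(g) = ∫_s K_f(x, y) ψ(y) dμ(y)`,
  `K_f(x, y) := ∑_{γ ∈ Γ} f(x⁻¹ γ y)`   (`poincare`; `integral_eq_integral_poincare`, `rightRegular_eq_integral_poincare`),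

whenever `g ↦ f(x⁻¹ g) ψ(g)` is integrable on `G`: Mathlib's `IsFundamentalDomain.integral_eq_tsum'`
(`∫_G F = ∑_γ ∫_s F(γ⁻¹ y)`), the invariance of `ψ`, the reindexing `γ ↦ γ⁻¹`, and the interchange of the sum and
the integral over `s` (`integral_tsum`, justified by `IsFundamentalDomain.lintegral_eq_tsum'` on `‖F‖`). The integral
over the fundamental domain `s` is the integral over the quotient `Γ\G`; the continuity of `K_f` is
`T7SupportPoincareContinuity`, and the integrability of `g ↦ f(x⁻¹ g) ψ(g)` (`f ∈ L¹(G)`, `ψ` bounded) is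
`integrable_of_bounded`.

Nothing here is about any specific group, any automorphic form, or any period.
Blind lane: Mathlib only; no sorry; axioms ⊆ {propext, Classical.choice, Quot.sound}.
-/

namespace Summit.Ventures.HodgeRepro2.T7SupportUnfolding

open MeasureTheory Filter Topology

variable {G : Type*} [Group G] [MeasurableSpace G] [MeasurableMul G] (Γ : Subgroup G) [Countable Γ]
  (μ : Measure G) [μ.IsMulLeftInvariant]

/-- left `Γ`-invariance of a function on `G` -/
def LeftInvariant (ψ : G → ℂ) : Prop := ∀ (γ : Γ) (g : G), ψ ((γ : G) * g) = ψ g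

/-- the Poincaré series (automorphization) of `f`: `K_f(x, y) = ∑_{γ ∈ Γ} f(x⁻¹ γ y)` -/
noncomputable def poincare (f : G → ℂ) (x y : G) : ℂ := ∑' γ : Γ, f (x⁻¹ * (γ : G) * y)

omit [MeasurableSpace G] [MeasurableMul G] [Countable Γ] in
/-- the invariance of `ψ` under `γ⁻¹` -/
theorem LeftInvariant.inv_mul {ψ : G → ℂ} (hψ : LeftInvariant Γ ψ) (γ : Γ) (g : G) :
    ψ ((γ : G)⁻¹ * g) = ψ g := by
  have := hψ γ⁻¹ g
  simpa using this

omit [Countable Γ] in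
/-- **the substitution `g ↦ x g`**: `∫ f(g) ψ(x g) = ∫ f(x⁻¹ g) ψ(g)` for a left-invariant `μ` -/
theorem integral_mul_eq_integral_inv_mul (f ψ : G → ℂ) (x : G) :
    ∫ g, f g * ψ (x * g) ∂μ = ∫ g, f (x⁻¹ * g) * ψ g ∂μ := by
  have h := integral_mul_left_eq_self (μ := μ) (fun g => f (x⁻¹ * g) * ψ g) x
  simp only [inv_mul_cancel_left] at h
  exact h

omit [Countable Γ] in
/-- `g ↦ f(x⁻¹ g) ψ(g)` is integrable for `f` integrable and `ψ` bounded measurable -/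
theorem integrable_of_bounded (f ψ : G → ℂ) (hf : Integrable f μ) (hψ : Measurable ψ) {C : ℝ}
    (hC : ∀ g, ‖ψ g‖ ≤ C) (x : G) : Integrable (fun g => f (x⁻¹ * g) * ψ g) μ := by
  have hfx : Integrable (fun g => f (x⁻¹ * g)) μ := hf.comp_mul_left x⁻¹
  exact hfx.mul_bdd hψ.aestronglyMeasurable (Eventually.of_forall hC)

omit [Countable Γ] in
/-- the term of the unfolded sum is measurable -/
theorem aestronglyMeasurable_term (f ψ : G → ℂ) (hf : Measurable f) (hψ : Measurable ψ) (x : G) (γ : Γ)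
    (ν : Measure G) : AEStronglyMeasurable (fun y => f (x⁻¹ * (γ : G) * y) * ψ y) ν :=
  ((hf.comp (measurable_const_mul _)).mul hψ).aestronglyMeasurable

/-- **the unfolding**: for `g ↦ f(x⁻¹ g) ψ(g)` integrable and `ψ` left-`Γ`-invariant,
`∫_G f(x⁻¹ g) ψ(g) = ∫_s K_f(x, y) ψ(y)` with `K_f(x, y) = ∑_{γ ∈ Γ} f(x⁻¹ γ y)`. -/
theorem integral_eq_integral_poincare {s : Set G} (hs : IsFundamentalDomain Γ s μ) (f ψ : G → ℂ)
    (hf : Measurable f) (hψm : Measurable ψ) (hψ : LeftInvariant Γ ψ) (x : G)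
    (hF : Integrable (fun g => f (x⁻¹ * g) * ψ g) μ) :
    ∫ g, f (x⁻¹ * g) * ψ g ∂μ = ∫ y in s, poincare Γ f x y * ψ y ∂μ := by
  -- the term after the substitution `y ↦ γ⁻¹ y`
  have hterm : ∀ (γ : Γ) (y : G), f (x⁻¹ * (γ⁻¹ • y)) * ψ (γ⁻¹ • y) = f (x⁻¹ * (γ : G)⁻¹ * y) * ψ y := by
    intro γ y
    have e1 : (γ⁻¹ • y) = (γ : G)⁻¹ * y := rfl
    rw [e1, LeftInvariant.inv_mul Γ hψ γ y, mul_assoc]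
  -- step 1: the fundamental-domain decomposition
  rw [hs.integral_eq_tsum' _ hF]
  simp_rw [hterm]
  -- step 2: reindex `γ ↦ γ⁻¹`
  have hre : (∑' γ : Γ, ∫ y in s, f (x⁻¹ * (γ : G)⁻¹ * y) * ψ y ∂μ) =
      ∑' γ : Γ, ∫ y in s, f (x⁻¹ * (γ : G) * y) * ψ y ∂μ := by
    have := (Equiv.inv Γ).tsum_eq fun γ : Γ => ∫ y in s, f (x⁻¹ * (γ : G) * y) * ψ y ∂μ
    simpa only [Equiv.inv_apply, Subgroup.coe_inv] using this
  rw [hre]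
  -- step 3: the interchange, justified by the finiteness of `∫ ‖F‖` through the same decomposition
  have hfin : (∑' γ : Γ, ∫⁻ y in s, ‖f (x⁻¹ * (γ : G) * y) * ψ y‖ₑ ∂μ) ≠ ⊤ := by
    have hlin := hs.lintegral_eq_tsum' fun g => ‖f (x⁻¹ * g) * ψ g‖ₑ
    have hterm' : ∀ (γ : Γ) (y : G), ‖f (x⁻¹ * (γ⁻¹ • y)) * ψ (γ⁻¹ • y)‖ₑ =
        ‖f (x⁻¹ * (γ : G)⁻¹ * y) * ψ y‖ₑ := fun γ y => by rw [hterm]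
    simp_rw [hterm'] at hlin
    have hre' : (∑' γ : Γ, ∫⁻ y in s, ‖f (x⁻¹ * (γ : G)⁻¹ * y) * ψ y‖ₑ ∂μ) =
        ∑' γ : Γ, ∫⁻ y in s, ‖f (x⁻¹ * (γ : G) * y) * ψ y‖ₑ ∂μ := by
      have := (Equiv.inv Γ).tsum_eq fun γ : Γ => ∫⁻ y in s, ‖f (x⁻¹ * (γ : G) * y) * ψ y‖ₑ ∂μ
      simpa only [Equiv.inv_apply, Subgroup.coe_inv] using this
    rw [hre'] at hlin
    rw [← hlin]
    exact (hasFiniteIntegral_iff_enorm.1 hF.hasFiniteIntegral).ne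
  rw [← integral_tsum (fun γ => aestronglyMeasurable_term Γ f ψ hf hψm x γ _) hfin]
  -- step 4: pull `ψ y` out of the sum
  unfold poincare
  congr 1
  funext y
  exact tsum_mul_right

/-- **`R(f)ψ(x) = ∫_s K_f(x, y) ψ(y)`**: the right-regular action of `f` on a left-`Γ`-invariant `ψ`, unfolded. -/
theorem rightRegular_eq_integral_poincare {s : Set G} (hs : IsFundamentalDomain Γ s μ) (f ψ : G → ℂ)
    (hf : Measurable f) (hψm : Measurable ψ) (hψ : LeftInvariant Γ ψ) (x : G)
    (hF : Integrable (fun g => f (x⁻¹ * g) * ψ g) μ) :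
    ∫ g, f g * ψ (x * g) ∂μ = ∫ y in s, poincare Γ f x y * ψ y ∂μ := by
  rw [integral_mul_eq_integral_inv_mul μ f ψ x]
  exact integral_eq_integral_poincare Γ μ hs f ψ hf hψm hψ x hF

/-- the same with the integrability supplied by `f ∈ L¹(G)` and `ψ` bounded -/
theorem rightRegular_eq_integral_poincare_of_bounded {s : Set G} (hs : IsFundamentalDomain Γ s μ) (f ψ : G → ℂ)
    (hf : Measurable f) (hfi : Integrable f μ) (hψm : Measurable ψ) (hψ : LeftInvariant Γ ψ) {C : ℝ}
    (hC : ∀ g, ‖ψ g‖ ≤ C) (x : G) :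
    ∫ g, f g * ψ (x * g) ∂μ = ∫ y in s, poincare Γ f x y * ψ y ∂μ :=
  rightRegular_eq_integral_poincare Γ μ hs f ψ hf hψm hψ x (integrable_of_bounded μ f ψ hfi hψm hC x)

end Summit.Ventures.HodgeRepro2.T7SupportUnfolding
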